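import Summits.BirchSwinnertonDyer.BirchSwinnertonDyer.Theorems.ErratumRoadFiveNonSurjCornerIndex
import Summits.BirchSwinnertonDyer.BirchSwinnertonDyer.Theorems.ClassRecordThreeCornerAtThreeKolyvagin

/-!
# Route `ErratumRoadFive` (rung K2a), crux 6 `NonSurjCorner` (item 19065): the KOLYVAGIN ROAD on the
# non-surjective corner at `p ∈ {5,7}` — the corner's STEP L (g0's residual hA, the anticyclotomic-IMC
# object with no print for a Cartan-normaliser image) REPLACED by Kolyvagin certificates on corner frames,
# through Kolyvagin's structure theorem under IRREDUCIBILITY (Cha 2005 Rmk. 25 ∕ Matar–Nekovář 2019 §0.11)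
# (cell `bsd-stepL`, seat `bsd-stepL-corner-p1` g2; `--supports stmt-BirchSwinnertonDyer-19065`)

Item 19065 is `Typed.MissingPPartAt W p` on the (T4′) corner of class X11b: `ρ̄_{E,p}` NOT onto,
`p ∈ {5,7}`, `p ∣ ord_p Δ_min`, no (ram) witness (automatic: an irreducible non-surjective image at a
multiplicative `p ≥ 5` is `N_s(p)` or the `𝔖₄` group at `5`, of order PRIME TO `p`). Session g0 split the
crux in the kernel (`ErratumRoadFiveNonSurjCorner{Upper,Lower,Index}.lean`): the Euler-system half is in the
cone of cruxes 19062 + 19064 + Matar–Nekovář 2019; the main-conjecture half needs STEP L on the corner in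
Gross–Zagier currency (`hL` of `erratumRoadFive_nonSurjCorner_of_indexLowerBoundNoSurj_of_twinUpper` —
residual hA, "programme object K6": every printed anticyclotomic divisibility at `p ∥ N` needs a ramified
multiplicative prime and an image `⊇ SL₂`) and the rank-`0` twin corner's upper half (`hT`).

THIS FILE supplies `hL` from KOLYVAGIN CERTIFICATES instead, through Kolyvagin's structure theorem for
IRREDUCIBLE `ρ̄_{E,p}` (Cha 2005 Rmk. 25; Matar–Nekovář 2019 §0.9 ∕ §0.11; Jetchev 2008 Rem. 6.2) = the facts
`Cha2005.rmk25_…` (p422597, flag `Cha05-Rmk25-structure`), whose hypotheses are AUTOMATIC on corner frames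
(non-CM, `p² ∤ N` from `p ∥ N`; `p ∤ d_K` from Heegner; `E[p]` irreducible; `d_K ≠ −3, −4` from `|d_K| > 4`):

* §1 `indexLowerBoundAt_corner_of_certificates` — at every datum of `hL`'s shape, a Kolyvagin certificate of
  level `M + 1`, `M ≤ t = ord_p ∏_ℓ c_ℓ(E)`, on the frame `(Dt, H.β, ι)` (binder **Zₚᶜ**, hypothesis shape:
  `∃ M ≤ t, Koly.CertificateAt Dt β ι p M`, i.e. `M_∞ ≤ t`; at `t = 0` Kolyvagin's conjecture `c_1(n) ≠ 0`)
  gives `X11b.IndexLowerBoundAt W p K P` (Darmon's conductor-`1` datum `hD36`, Shimura reciprocity `hrec`,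
  Gross–Zagier + Kolyvagin for rank one ∕ finiteness, irreducibility for no `p`-torsion; file
  `ClassRecordThreeCornerAtThreeKolyvagin` §1).
* §2 **`erratumRoadFive_nonSurjCorner_of_certificates_of_twinUpper : pubs(+hrec, hD36, hChaL) → EulerHalfOffLocus
  → X11aLowerHalf → Zₚᶜ → hT → NonSurjCorner`** — g0's `…_of_indexLowerBoundNoSurj_of_twinUpper` with its
  residual hA ∕ `hL` (STEP L on the corner, the IMC-type object) SUPPLIED by §1; **Zₚᶜ** quantified over all
  corner frames; **hT** = g0's twin input verbatim. The IMC-type input is GONE.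
* §3 `missingUpperBoundAt_corner_of_jetchevDivisibility_of_lowerX11a` — the corner's Euler-system half
  from the Jetchev direction **Jₚᶜ** (`M_∞ ≥ t` on corner frames) + X11a's lower half on the twin: the
  SHARPENED `K`-bound from file `ClassRecordThreeCornerAtThreeKolyvagin` §1 descended with x11b3's
  `missingUpperBoundAt_of_shaIndexBound_sharp` (weight `t`) — crux `EulerHalfOffLocus` is NOT used.
* §4 **`erratumRoadFive_nonSurjCorner_of_refinedKolyvagin_of_twin : pubs → X11aLowerHalf → Zₚᶜ → Jₚᶜ →
  hT → NonSurjCorner`** — the corner = the refined Kolyvagin conjecture `M_∞ = t` on its own frames + the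
  twin pair's `p`-part; neither an IMC-type input nor `EulerHalfOffLocus` appears.

HONEST FRAMING. Zₚᶜ, Jₚᶜ, hT are hypothesis SHAPES (no `def`, no named fact); nothing here proves them; item
19065 does NOT close; the leaf is untouched; no census word moves. What the file buys: on the corner NO
anticyclotomic main conjecture is needed — its own input is a statement about `p`-divisibility of derived
Heegner points on its frames (finitely certifiable per pair); beyond it only the rank-`0` twin's `p`-part
remains (hT + `X11aLowerHalf` on the twin), as at `3`. Flag `Cha05-Rmk25-structure`. CONDITIONAL throughout.

References: [Cha2005] Thm. 21, Rmk. 25; [MatarNekovar2019] Thm. 0.7, §0.9, §0.11; [Jetchev2008] Conj. 1.3,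
Rem. 6.2; [McCallumLMS1991] §5 Cor. 5.6; [WZhang2014] Thm. 1.1, Rem. 5; [JetchevSkinnerWan2017] §7.4.1–7.4.2;
[Darmon2004] Thm. 3.6; [Miller2011LMS] Def. 1.1; tree: g0's `Theorems/ErratumRoadFiveNonSurjCorner*.lean`.
-/

noncomputable section

open scoped Classical NumberField

namespace Summit.BirchSwinnertonDyer.Rank1Residual.X11b

open WeierstrassCurve NumberField IsDedekindDomain Field Literature.NumberTheory.EllipticCurves
  Literature.NumberTheory.EllipticCurves.ModularForms
  Literature.NumberTheory.EllipticCurves.Rank1Residual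
  Literature.NumberTheory.EllipticCurves.Rank1Residual.Typed
  Literature.NumberTheory.EllipticCurves.Wuthrich2014
  Literature.NumberTheory.QuadraticFields.Quadratic
  Summit.BirchSwinnertonDyer.Rank1Residual
  Summit.BirchSwinnertonDyer.Rank1Residual.X11b.Three.Koly

/-! ### §1 STEP L in Gross–Zagier currency on the corner from Kolyvagin certificates -/

/-- **STEP L in Gross–Zagier currency at a Manin-good Heegner datum of a corner pair, from ONE Kolyvagin
certificate of level `≤ t + 1` on its frame** (`p ∈ {5,7}`; in fact any multiplicative `p ≥ 5` with
`E[p]` irreducible — `¬Surj`, `p ∣ ord_p Δ_min`, `¬Ram` are not used). Data: the shape of the binder `hL`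
of g0's `erratumRoadFive_nonSurjCorner_of_indexLowerBoundNoSurj_of_twinUpper` (`K` imaginary quadratic
with `|d_K| > 4`, Heegner for `N = N_E` and for `p`, `L(E^{d_K},1) ≠ 0`, `Dt` of level `N` with `p ∤ c`,
`P ∈ E(K)` THE Heegner point of `(Dt, H, ι)`, of infinite order). PUBLISHED binders: Gross–Zagier (`hGZ`),
Kolyvagin (`hKo`), modularity (`hmod`), Shimura reciprocity at conductor `1` (`hrec`), Darmon 2004 Thm. 3.6
(`hD36`), the structure fact `hChaL`. Typed input **Zₚᶜ** (`hZ`): `∃ M ≤ ord_p ∏_ℓ c_ℓ(E)`,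
`Koly.CertificateAt Dt H.β ι p M`. CONDITIONAL on `hZ` and `hChaL`; nothing booked.
[cite: Cha2005, Thm. 21 and Rmk. 25 (pp. 173–175)] [cite: MatarNekovar2019, §0.9 and §0.11 (p. 457)]
[cite: McCallumLMS1991, §5 Cor. 5.6 (p. 310) and Lemma 5.1 (p. 303)] [cite: Darmon2004, Thm. 3.6 (PDF p. 43)]
[cite: GrossLMS1991, §4 (4.1)] -/
theorem indexLowerBoundAt_corner_of_certificates
    (hGZ : ∀ (N : ℕ) [NeZero N] (W : WeierstrassCurve ℚ) (K : Type) [Field K] [NumberField K],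
      gross_zagier N W K)
    (hKo : ∀ (N : ℕ) [NeZero N] (W : WeierstrassCurve ℚ) (K : Type) [Field K] [NumberField K],
      kolyvagin N W K)
    (hmod : hasEntireLFunction_rat)
    (hrec : ∀ (N : ℕ) [NeZero N] (W : WeierstrassCurve ℚ) (K : Type) [Field K] [NumberField K],
      heegnerPointOfConductor_one_galoisConj N W K)
    (hD36 : ∀ (N : ℕ) [NeZero N] (W : WeierstrassCurve ℚ) (K : Type) [Field K] [NumberField K],
      phi_heegnerTau_mem_singularModuliField N W K)
    (hChaL : Cha2005.rmk25_pow_dvd_card_sha_primary_of_certificate)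
    (W : WeierstrassCurve ℚ) [W.IsElliptic] [W.IsGloballyMinimal] (p : ℕ) [Fact p.Prime]
    (N : ℕ) [NeZero N] (K : Type) [Field K] [NumberField K]
    (Dt : ModularParametrizationData W N) (H : HeegnerDatum N (NumberField.discr K)) (ι : K →+* ℂ)
    (P : (W.baseChange K).toAffine.Point)
    (hX : ClassX11b W p) (hp5 : 5 ≤ p) (hN : W.conductorNorm ℤ = N) (hK : IsImaginaryQuadratic K)
    (hdisc : 4 < (NumberField.discr K).natAbs) (hHN : SatisfiesHeegnerHypothesis N K)
    (hLt : (W.quadraticTwist (NumberField.discr K : ℚ)).entireLFunction 1 ≠ 0)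
    (hP : WeierstrassCurve.Affine.Point.map ι.toRatAlgHom P = heegnerPointComplex Dt H)
    (hPinf : ¬ IsOfFinAddOrder P)
    -- Zₚᶜ at this frame: a Kolyvagin certificate of level M + 1 with M ≤ t
    (hZ : ∃ M : ℕ, M ≤ padicValNat p W.tamagawaProduct ∧ CertificateAt Dt H.β ι p M) :
    IndexLowerBoundAt W p K P := by
  subst hN
  have hp : p.Prime := Fact.out
  have hp2 : p ≠ 2 := by omega
  obtain ⟨hr, _, hmult, hirr⟩ := id hX
  -- `d_K ∉ {−3, −4}` from `|d_K| > 4`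
  have h3 : NumberField.discr K ≠ -3 := by intro hd; rw [hd] at hdisc; simp at hdisc
  have h4 : NumberField.discr K ≠ -4 := by intro hd; rw [hd] at hdisc; simp at hdisc
  -- `Ш(E/K)` finite (Gross–Zagier + Kolyvagin) and rank one
  haveI : Finite (W.baseChange K).sha :=
    finite_sha_baseChange_of_heegner W _ K Dt H ι P (hGZ _ W K) (hKo _ W K) hmod hr hK hHN hLt hP
  obtain ⟨hrank, -⟩ := hKo (W.conductorNorm ℤ) W K hK hHN ⟨Dt, H, ι, hP⟩ hPinf
  -- no p-torsion over K (irreducibility)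
  have hbot := torsionBy_eq_bot_of_isImaginaryQuadratic_of_hasIrreducibleModPGaloisRep W K hK hp hirr
  have hiv : ∀ x : (W.baseChange K).toAffine.Point, p • x = 0 → x = 0 := fun x hx ↦ by
    have hmem : x ∈ AddSubgroup.torsionBy (W.baseChange K).toAffine.Point ((p : ℕ) : ℤ) := by
      rw [mem_torsionBy_iff, natCast_zsmul]
      exact hx
    rw [hbot] at hmem
    exact hmem
  -- Darmon's conductor-1 datum on the frame (Dt, H.β, ι) and its bottom point P_1 = y_K = P
  obtain ⟨d₁⟩ := exists_kolyvaginHeegnerData_one (hD36 _ W K) hK Dt H.β ι H.dvd_sq_sub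
  have hPd : d₁.toGeomPoints d₁.derivedPoint = toGeomPoints (W.baseChange K) P :=
    KolyvaginBottom.toGeomPoints_derivedPoint_one_eq (hrec _ W K) hK hHN hP d₁ rfl
  obtain ⟨M, hMt, hcert⟩ := hZ
  exact indexLowerBoundAt_of_certificateAt_of_irreducible hChaL W K p hp2 hmult hirr hK h3 h4 hHN Dt H.β
    ι d₁ P hPd hPinf hrank hiv hcert hMt

/-! ### §2 Crux `NonSurjCorner` from certificates on corner frames + the twin's upper half -/

open Summit.BirchSwinnertonDyer.BirchSwinnertonDyer.Theses.ErratumRoadFive in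
/-- **Crux `NonSurjCorner` (item 19065) ON THE KOLYVAGIN ROAD: ⇐ Kolyvagin certificates on corner frames
(Zₚᶜ) + the Euler-system half of the rank-`0` TWIN corner (hT)**, modulo the PUBLISHED facts
Gross–Zagier (`hGZ`), Kolyvagin (`hKo`), Wuthrich 2014 (`hWu`), Matar–Nekovář 2019 (`hMN`), GZK,
modularity (`hmod`, `hnf`), Friedberg–Hoffstein split field (`hFHs`), Mazur 1978 Cor. 4.1 (`hMaz`), Shimura
reciprocity (`hrec`), Darmon 3.6 (`hD36`), the Cha ∕ MN19 structure fact (`hChaL`), and the route's cruxes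
`EulerHalfOffLocus` (`h₂`, 19062) and `X11aLowerHalf` (`h₄`, 19064) BY NAME. **Zₚᶜ** (`hZ`, hypothesis
shape): on every Manin-good conductor-`N_E` frame `(Dt, β, ι)` of a corner pair (`ClassX11b W p`,
`¬ Surj W p`, `p ∈ {5,7}`, `p ∣ ord_p Δ_min`, `¬ Ram W p`) over an imaginary quadratic `K` with `|d_K| > 4`,
Heegner for `N_E` and for `p`, THERE IS a Kolyvagin certificate of some level `M + 1` with
`M ≤ ord_p ∏_ℓ c_ℓ(E)` (`M_∞ ≤ t`). **hT**: g0's twin input verbatim. This is g0's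
`erratumRoadFive_nonSurjCorner_of_indexLowerBoundNoSurj_of_twinUpper` with its residual hA ∕ `hL` (STEP L
on the corner — the IMC-type object) SUPPLIED by §1. CONDITIONAL on `hZ`, `hT`, `h₂`, `h₄`; does NOT
close item 19065; nothing booked. [cite: Cha2005, Rmk. 25 (p. 175)] [cite: MatarNekovar2019, §0.9, §0.11 (p. 457)]
[cite: McCallumLMS1991, §5 Cor. 5.6 (p. 310)] [cite: WZhang2014, Thm. 1.1 and Rem. 5 (shape of Zₚᶜ at t = 0)]
[cite: JetchevSkinnerWan2017, §7.4.1–7.4.2 (pp. 30–31)] [cite: Miller2011LMS, Def. 1.1] -/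
theorem erratumRoadFive_nonSurjCorner_of_certificates_of_twinUpper
    (hGZ : ∀ (N : ℕ) [NeZero N] (W : WeierstrassCurve ℚ) (K : Type) [Field K] [NumberField K],
      gross_zagier N W K)
    (hKo : ∀ (N : ℕ) [NeZero N] (W : WeierstrassCurve ℚ) (K : Type) [Field K] [NumberField K],
      kolyvagin N W K)
    (hWu : sha_dvd_analyticSha)
    (hMN : ∀ (N : ℕ) [NeZero N] (W : WeierstrassCurve ℚ) (K : Type) [Field K] [NumberField K],
      MatarNekovar2019.thm03_padicValNat_card_sha_le_of_irreducible N W K)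
    (hGZK : rank_eq_analyticRank_of_analyticRank_le_one) (hmod : hasEntireLFunction_rat)
    (hnf : exists_isNewformOf) (hFHs : friedbergHoffstein_exists_heegnerField_split_twist_ne_zero)
    (hMaz : mazur_not_dvd_maninConstant_of_odd)
    (hrec : ∀ (N : ℕ) [NeZero N] (W : WeierstrassCurve ℚ) (K : Type) [Field K] [NumberField K],
      heegnerPointOfConductor_one_galoisConj N W K)
    (hD36 : ∀ (N : ℕ) [NeZero N] (W : WeierstrassCurve ℚ) (K : Type) [Field K] [NumberField K],
      phi_heegnerTau_mem_singularModuliField N W K)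
    (hChaL : Cha2005.rmk25_pow_dvd_card_sha_primary_of_certificate)
    (h₂ : Summit.BirchSwinnertonDyer.BirchSwinnertonDyer.Theses.ErratumRoadFive.EulerHalfOffLocus)
    (h₄ : Summit.BirchSwinnertonDyer.BirchSwinnertonDyer.Theses.ErratumRoadFive.X11aLowerHalf)
    -- Zₚᶜ: certificates on corner frames (hypothesis shape; the refined Kolyvagin conjecture's ≤-half)
    (hZ : ∀ (W : WeierstrassCurve ℚ) [W.IsElliptic] [W.IsGloballyMinimal] (p : ℕ) [Fact p.Prime]
      (N : ℕ) [NeZero N] (K : Type) [Field K] [NumberField K]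
      (Dt : ModularParametrizationData W N) (β : ℤ) (ι : K →+* ℂ),
      ClassX11b W p → ¬ Surj W p → (p = 5 ∨ p = 7) → p ∣ padicValInt p W.minimalDiscriminantInt →
      ¬ Ram W p → W.conductorNorm ℤ = N → IsImaginaryQuadratic K →
      4 < (NumberField.discr K).natAbs → SatisfiesHeegnerHypothesis N K →
      SatisfiesHeegnerHypothesis p K → (4 * (N : ℤ)) ∣ β ^ 2 - NumberField.discr K → ¬ (p : ℤ) ∣ Dt.c →
      ∃ M : ℕ, M ≤ padicValNat p W.tamagawaProduct ∧ CertificateAt Dt β ι p M)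
    -- hT: the Euler-system half on the rank-0 TWIN corner (g0's residual 2, verbatim)
    (hT : ∀ (Wd : WeierstrassCurve ℚ) [Wd.IsElliptic] [Wd.IsGloballyMinimal] (p : ℕ) [Fact p.Prime],
      ClassX11a Wd p → ¬ Surj Wd p → (p = 5 ∨ p = 7) →
      p ∣ padicValInt p Wd.minimalDiscriminantInt → Typed.MissingUpperBoundAt Wd p) :
    Summit.BirchSwinnertonDyer.BirchSwinnertonDyer.Theses.ErratumRoadFive.NonSurjCorner :=
  erratumRoadFive_nonSurjCorner_of_indexLowerBoundNoSurj_of_twinUpper hGZ hKo hWu hMN hGZK hmod hnf hFHs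
    hMaz h₂ h₄
    (fun W _ _ p _ N _ K _ _ Dt H ι P hX hns h57 hv hnr hN hK hdisc hHN hHp hLt hP hc hPinf ↦
      indexLowerBoundAt_corner_of_certificates hGZ hKo hmod hrec hD36 hChaL W p N K Dt H ι P hX
        (by rcases h57 with h | h <;> omega) hN hK hdisc hHN hLt hP hPinf
        (hZ W p N K Dt H.β ι hX hns h57 hv hnr hN hK hdisc hHN hHp H.dvd_sq_sub hc))
    hT

/-! ### §3 The Euler-system half on the corner from the Jetchev direction Jₚᶜ (no `EulerHalfOffLocus`) -/

/-- **The Euler-system half `Typed.MissingUpperBoundAt W p` on the corner at `p ≥ 5` from the JETCHEV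
DIRECTION on the pair's frames + X11a's lower half on the twin** — the `p ≥ 5` twin of
`Koly.cornerUpperAt_of_jetchevDivisibility_of_irreducible` descended to `ℚ`. For `(E,p) ∈` X11b with
`p ∈ {5,7}` and `¬ Ram W p` (any image; the corner is the case `¬ Surj`): at the Friedberg–Hoffstein field of
the pair (`hFHs`: `|d_K| > 4`, every `ℓ ∣ N_E` and `p` split, `L(E^{d_K},1) ≠ 0`) with a Manin-good
parametrisation (`exists_modularParametrizationData_not_dvd`: modularity, Mazur 1978 Cor. 4.1, Néron
scaling), the SHARPENED bound `ord_p #Ш(E/K) + 2t ≤ 2·ord_p[E(K):ℤP]`, `t = ord_p ∏_ℓ c_ℓ(E)`, comes from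
Jₚᶜ (`hJ`, hypothesis shape: `M_∞ ≥ t` on corner frames) + Kolyvagin's structure theorem under
irreducibility (`hChaU`) + Darmon 3.6 (`hD36`) + Shimura reciprocity (`hrec`) (file
`ClassRecordThreeCornerAtThreeKolyvagin` §1), and the twist's `≥`-half from X11a's lower half (`hX11a`, crux
`X11aLowerHalf` by shape; the twists are X11a pairs, `classX11a_twist_of_not_ram`); then x11b3's
`missingUpperBoundAt_of_shaIndexBound_sharp` with weight `t`. So on the corner the Euler-system half needs
crux `EulerHalfOffLocus` (19062) NO LONGER (g0 used its `¬Ram` branch on `p ∣ ∏c`). CONDITIONAL on `hJ`,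
`hX11a`, `hChaU`; nothing booked. [cite: Cha2005, Rmk. 25 (p. 175)] [cite: MatarNekovar2019, §0.9, §0.11 (p. 457)]
[cite: McCallumLMS1991, §5 Cor. 5.6 (p. 310)] [cite: Jetchev2008, Conj. 1.3 and (1) (p. 812)]
[cite: JetchevSkinnerWan2017, §7.4.2 (p. 31)] [cite: Mazur1978, Cor. 4.1] [cite: Miller2011LMS, Def. 1.1] -/
theorem missingUpperBoundAt_corner_of_jetchevDivisibility_of_lowerX11a
    (hGZ : ∀ (N : ℕ) [NeZero N] (W : WeierstrassCurve ℚ) (K : Type) [Field K] [NumberField K],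
      gross_zagier N W K)
    (hKo : ∀ (N : ℕ) [NeZero N] (W : WeierstrassCurve ℚ) (K : Type) [Field K] [NumberField K],
      kolyvagin N W K)
    (hGZK : rank_eq_analyticRank_of_analyticRank_le_one) (hmod : hasEntireLFunction_rat)
    (hnf : exists_isNewformOf) (hFHs : friedbergHoffstein_exists_heegnerField_split_twist_ne_zero)
    (hMaz : mazur_not_dvd_maninConstant_of_odd)
    (hrec : ∀ (N : ℕ) [NeZero N] (W : WeierstrassCurve ℚ) (K : Type) [Field K] [NumberField K],
      heegnerPointOfConductor_one_galoisConj N W K)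
    (hD36 : ∀ (N : ℕ) [NeZero N] (W : WeierstrassCurve ℚ) (K : Type) [Field K] [NumberField K],
      phi_heegnerTau_mem_singularModuliField N W K)
    (hChaU : Cha2005.rmk25_padicValNat_card_sha_primary_add_le_of_globalDivisibility)
    (W : WeierstrassCurve ℚ) [W.IsElliptic] [W.IsGloballyMinimal] (p : ℕ) [Fact p.Prime]
    (hX : ClassX11b W p) (h57 : p = 5 ∨ p = 7) (hnr : ¬ Ram W p)
    -- X11a's lower half on the twists (crux `X11aLowerHalf`, by shape)
    (hX11a : ∀ (Wd : WeierstrassCurve ℚ) [Wd.IsElliptic] [Wd.IsGloballyMinimal],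
      ClassX11a Wd p → Typed.MissingLowerBoundAt Wd p)
    -- Jₚᶜ: the Jetchev direction `M_∞ ≥ t` on the corner frames of THIS pair (hypothesis shape)
    (hJ : ∀ [NeZero (W.conductorNorm ℤ)] (K : Type) [Field K] [NumberField K]
      (Dt : ModularParametrizationData W (W.conductorNorm ℤ)) (β : ℤ) (ι : K →+* ℂ),
      IsImaginaryQuadratic K → 4 < (NumberField.discr K).natAbs →
      SatisfiesHeegnerHypothesis (W.conductorNorm ℤ) K → SatisfiesHeegnerHypothesis p K →
      (4 * (W.conductorNorm ℤ : ℤ)) ∣ β ^ 2 - NumberField.discr K → ¬ (p : ℤ) ∣ Dt.c →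
      ∀ (s : ℕ), s ≤ padicValNat p W.tamagawaProduct →
        ∀ (n : ℕ) (d : KolyvaginHeegnerData Dt β ι n), Squarefree n →
          (∀ ℓ ∈ n.primeFactors, Zhang2014.IsKolyvaginPrime (W.conductorNorm ℤ) W K p ℓ ∧
            s ≤ Zhang2014.kolyvaginIndex W p ℓ) → PDiv d p s) :
    Typed.MissingUpperBoundAt W p := by
  have hNS : integral_neronScaling_of_isGloballyMinimal :=
    integral_neronScaling_of_isGloballyMinimal_holds
  haveI : NeZero (W.conductorNorm ℤ) := ⟨(W.conductorNorm_pos_holds).ne'⟩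
  have hp : p.Prime := Fact.out
  have hp5 : 5 ≤ p := by rcases h57 with h | h <;> omega
  have hp2 : p ≠ 2 := by omega
  obtain ⟨hr, _, hmult, hirr⟩ := id hX
  -- a Manin-good parametrisation of level N_E (p² ∤ N)
  have hpN : ¬ p ^ 2 ∣ W.conductorNorm ℤ := not_sq_dvd_conductorNorm_of_mult W p hmult
  obtain ⟨D, hc⟩ := exists_modularParametrizationData_not_dvd hnf hMaz hNS W rfl hp hp2 hpN hirr
  -- the Friedberg–Hoffstein Heegner field: |d_K| > 4, every ℓ ∣ N_E and p split, L(E^{d_K},1) ≠ 0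
  have hw : W.rootNumber = -1 := by
    rw [WeierstrassCurve.rootNumber_eq_neg_one_pow_analyticRank_of_exists_isNewformOf hnf W, hr]
    norm_num
  obtain ⟨K, _, _, hK, hdisc, hHN, hHp, hLt⟩ := hFHs W hw p hp 4
  haveI : IsTotallyComplex K := hK.2
  have hneg : NumberField.discr K < 0 := discr_neg_of_finrank_eq_two K hK.1
  have h4lt : NumberField.discr K < -4 := by
    have habs : ((NumberField.discr K).natAbs : ℤ) = -NumberField.discr K :=
      Int.ofNat_natAbs_of_nonpos hneg.le
    have : (4 : ℤ) < ((NumberField.discr K).natAbs : ℤ) := by exact_mod_cast hdisc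
    omega
  have h3 : NumberField.discr K ≠ -3 := by omega
  have h4 : NumberField.discr K ≠ -4 := by omega
  have hμ : ¬ p ∣ Units.torsionOrder K := by
    rw [Literature.NumberTheory.DiophantineGeometry.torsionOrder_eq_two_of_discr_lt hK.1 h4lt]
    intro h2
    have := Nat.le_of_dvd two_pos h2
    omega
  obtain ⟨H, -⟩ := nonempty_heegnerDatum_holds (W.conductorNorm ℤ) K hK
    (exists_dvd_sq_sub_discr_holds (W.conductorNorm ℤ) K hK hHN).choose_spec
  obtain ⟨ι⟩ : Nonempty (K →+* ℂ) := inferInstance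
  obtain ⟨P, hP⟩ := heegnerPointComplex_mem_range_map_holds (W.conductorNorm ℤ) W K hK hHN D H ι
  -- the minimal twist model and its rank-0 lower half (an X11a pair)
  have hD0 : (NumberField.discr K : ℚ) ≠ 0 := by exact_mod_cast NumberField.discr_ne_zero K
  haveI hEt : (W.quadraticTwist (NumberField.discr K : ℚ)).IsElliptic :=
    W.isElliptic_quadraticTwist hD0
  obtain ⟨Cd, hCd⟩ := hasGlobalMinimalModel_rat_holds (W.quadraticTwist (NumberField.discr K : ℚ))
  haveI : (Cd • W.quadraticTwist (NumberField.discr K : ℚ)).IsGloballyMinimal := hCd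
  set Wd := Cd • W.quadraticTwist (NumberField.discr K : ℚ) with hWd_def
  have hWd : Cd • W.quadraticTwist (NumberField.discr K : ℚ) = Wd := rfl
  have hrd : Wd.analyticRank = 0 := by
    rw [hWd_def, analyticRank_smul]
    exact analyticRank_eq_zero_of_entireLFunction_one_ne_zero _ hLt
  have hXa : ClassX11a Wd p := classX11a_twist_of_not_ram W p hX hnr K hK hHN Cd hWd hrd
  have hirrd : Wd.HasIrreducibleModPGaloisRep p := hXa.2.2.2.1
  obtain ⟨qd, hqd, hvqd⟩ :=
    AdditivePotMult.exists_printShape_lower_of_missingLowerBoundAt_rankZero (p := p) Wd hGZK hrd hirrd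
      (hX11a Wd hXa)
  have htam : padicValNat p Wd.tamagawaProduct = padicValNat p W.tamagawaProduct :=
    padicValNat_tamagawaProduct_twist_of_heegner W p hp5 K hK hHN Cd hWd
  have hu : padicValRat p (Cd.u : ℚ) = 0 :=
    AdditivePotMult.padicValRat_u_eq_zero_of_twist_minimal_of_split W p K hK hHp Cd hWd
  -- no p-torsion over K (irreducibility)
  have hbot := torsionBy_eq_bot_of_isImaginaryQuadratic_of_hasIrreducibleModPGaloisRep W K hK hp hirr
  have hiv : ∀ x : (W.baseChange K).toAffine.Point, p • x = 0 → x = 0 := fun x hx ↦ by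
    have hmem : x ∈ AddSubgroup.torsionBy (W.baseChange K).toAffine.Point ((p : ℕ) : ℤ) := by
      rw [mem_torsionBy_iff, natCast_zsmul]
      exact hx
    rw [hbot] at hmem
    exact hmem
  -- Darmon's conductor-1 datum on the frame (D, H.β, ι) and its bottom point
  obtain ⟨d₁⟩ := exists_kolyvaginHeegnerData_one (hD36 _ W K) hK D H.β ι H.dvd_sq_sub
  have hPd : d₁.toGeomPoints d₁.derivedPoint = toGeomPoints (W.baseChange K) P :=
    KolyvaginBottom.toGeomPoints_derivedPoint_one_eq (hrec _ W K) hK hHN hP d₁ rfl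
  -- descent to ℚ with weight t = ord_p ∏c (x11b3's sharp bookkeeping)
  refine missingUpperBoundAt_of_shaIndexBound_sharp W p (W.conductorNorm ℤ) K D H ι P (hGZ _ W K)
    (hKo _ W K) hGZK hmod hK hHN hP hp2 hc hμ hr hLt Wd Cd hWd hu htam le_rfl ⟨qd, hqd, hvqd⟩ ?_
  intro hfinK hPinf
  haveI : Finite (W.baseChange K).sha := hfinK
  obtain ⟨hrank, -⟩ := hKo (W.conductorNorm ℤ) W K hK hHN ⟨D, H, ι, hP⟩ hPinf
  exact shaIndexBound_sharp_of_globalDivisibility_of_irreducible hChaU W K p hp2 hmult hirr hK h3 h4 hHN D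
    H.β ι d₁ P hPd hPinf hrank hiv (hJ K D H.β ι hK hdisc hHN hHp H.dvd_sq_sub hc)

/-! ### §4 Crux `NonSurjCorner` from the refined Kolyvagin conjecture on corner frames + the twin —
no `EulerHalfOffLocus`, no STEP L -/

open Summit.BirchSwinnertonDyer.BirchSwinnertonDyer.Theses.ErratumRoadFive in
/-- **Crux `NonSurjCorner` (item 19065) ⇐ {Zₚᶜ, Jₚᶜ} (the refined Kolyvagin conjecture `M_∞ = t` on corner
frames, two hypothesis shapes) + the rank-`0` TWIN's `p`-part (hT: its Euler-system half on the twin corner;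
crux `X11aLowerHalf` `h₄`: its main-conjecture half) + PUBLISHED facts** (Gross–Zagier, Kolyvagin, Wuthrich
2014, GZK, modularity ×2, Friedberg–Hoffstein split field, Mazur 1978 Cor. 4.1, Shimura reciprocity, Darmon
3.6, the two structure facts under irreducibility). Lower half: g0's
`missingLowerBoundAt_of_classX11b_of_indexLowerBoundNoSurj_of_upperTwist` with STEP L from certificates
(§1); upper half: §3. Neither `OpenInputIMC`-type input nor `EulerHalfOffLocus` appears: the corner is the
refined Kolyvagin conjecture on its own frames plus the twin pair's `BSD_p`. CONDITIONAL on `hZ`, `hJ`,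
`hT`, `h₄`; does NOT close item 19065; nothing booked. [cite: Cha2005, Rmk. 25 (p. 175)]
[cite: MatarNekovar2019, §0.9, §0.11 (p. 457)] [cite: McCallumLMS1991, §5 Cor. 5.6 (p. 310)]
[cite: Jetchev2008, Conj. 1.3 (p. 812)] [cite: JetchevSkinnerWan2017, §7.4.1–7.4.2 (pp. 30–31)]
[cite: Miller2011LMS, Def. 1.1] -/
theorem erratumRoadFive_nonSurjCorner_of_refinedKolyvagin_of_twin
    (hGZ : ∀ (N : ℕ) [NeZero N] (W : WeierstrassCurve ℚ) (K : Type) [Field K] [NumberField K],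
      gross_zagier N W K)
    (hKo : ∀ (N : ℕ) [NeZero N] (W : WeierstrassCurve ℚ) (K : Type) [Field K] [NumberField K],
      kolyvagin N W K)
    (hWu : sha_dvd_analyticSha)
    (hGZK : rank_eq_analyticRank_of_analyticRank_le_one) (hmod : hasEntireLFunction_rat)
    (hnf : exists_isNewformOf) (hFHs : friedbergHoffstein_exists_heegnerField_split_twist_ne_zero)
    (hMaz : mazur_not_dvd_maninConstant_of_odd)
    (hrec : ∀ (N : ℕ) [NeZero N] (W : WeierstrassCurve ℚ) (K : Type) [Field K] [NumberField K],
      heegnerPointOfConductor_one_galoisConj N W K)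
    (hD36 : ∀ (N : ℕ) [NeZero N] (W : WeierstrassCurve ℚ) (K : Type) [Field K] [NumberField K],
      phi_heegnerTau_mem_singularModuliField N W K)
    (hChaL : Cha2005.rmk25_pow_dvd_card_sha_primary_of_certificate)
    (hChaU : Cha2005.rmk25_padicValNat_card_sha_primary_add_le_of_globalDivisibility)
    (h₄ : Summit.BirchSwinnertonDyer.BirchSwinnertonDyer.Theses.ErratumRoadFive.X11aLowerHalf)
    -- Zₚᶜ: certificates on corner frames (`M_∞ ≤ t`)
    (hZ : ∀ (W : WeierstrassCurve ℚ) [W.IsElliptic] [W.IsGloballyMinimal] (p : ℕ) [Fact p.Prime]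
      (N : ℕ) [NeZero N] (K : Type) [Field K] [NumberField K]
      (Dt : ModularParametrizationData W N) (β : ℤ) (ι : K →+* ℂ),
      ClassX11b W p → ¬ Surj W p → (p = 5 ∨ p = 7) → p ∣ padicValInt p W.minimalDiscriminantInt →
      ¬ Ram W p → W.conductorNorm ℤ = N → IsImaginaryQuadratic K →
      4 < (NumberField.discr K).natAbs → SatisfiesHeegnerHypothesis N K →
      SatisfiesHeegnerHypothesis p K → (4 * (N : ℤ)) ∣ β ^ 2 - NumberField.discr K → ¬ (p : ℤ) ∣ Dt.c →
      ∃ M : ℕ, M ≤ padicValNat p W.tamagawaProduct ∧ CertificateAt Dt β ι p M)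
    -- Jₚᶜ: the Jetchev direction on corner frames (`M_∞ ≥ t`)
    (hJ : ∀ (W : WeierstrassCurve ℚ) [W.IsElliptic] [W.IsGloballyMinimal] [NeZero (W.conductorNorm ℤ)]
      (p : ℕ) [Fact p.Prime] (K : Type) [Field K] [NumberField K]
      (Dt : ModularParametrizationData W (W.conductorNorm ℤ)) (β : ℤ) (ι : K →+* ℂ),
      ClassX11b W p → ¬ Surj W p → (p = 5 ∨ p = 7) → p ∣ padicValInt p W.minimalDiscriminantInt →
      ¬ Ram W p → IsImaginaryQuadratic K → 4 < (NumberField.discr K).natAbs →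
      SatisfiesHeegnerHypothesis (W.conductorNorm ℤ) K → SatisfiesHeegnerHypothesis p K →
      (4 * (W.conductorNorm ℤ : ℤ)) ∣ β ^ 2 - NumberField.discr K → ¬ (p : ℤ) ∣ Dt.c →
      ∀ (s : ℕ), s ≤ padicValNat p W.tamagawaProduct →
        ∀ (n : ℕ) (d : KolyvaginHeegnerData Dt β ι n), Squarefree n →
          (∀ ℓ ∈ n.primeFactors, Zhang2014.IsKolyvaginPrime (W.conductorNorm ℤ) W K p ℓ ∧
            s ≤ Zhang2014.kolyvaginIndex W p ℓ) → PDiv d p s)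
    -- hT: the Euler-system half on the rank-0 TWIN corner (g0's residual 2, verbatim)
    (hT : ∀ (Wd : WeierstrassCurve ℚ) [Wd.IsElliptic] [Wd.IsGloballyMinimal] (p : ℕ) [Fact p.Prime],
      ClassX11a Wd p → ¬ Surj Wd p → (p = 5 ∨ p = 7) →
      p ∣ padicValInt p Wd.minimalDiscriminantInt → Typed.MissingUpperBoundAt Wd p) :
    Summit.BirchSwinnertonDyer.BirchSwinnertonDyer.Theses.ErratumRoadFive.NonSurjCorner := by
  intro W _ _ p _ hX hns h57 hv hnr
  have hp5 : 5 ≤ p := by rcases h57 with h | h <;> omega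
  refine Typed.missingPPartAt_of_lower_of_upper W p ?_
    (missingUpperBoundAt_corner_of_jetchevDivisibility_of_lowerX11a hGZ hKo hGZK hmod hnf hFHs hMaz hrec
      hD36 hChaU W p hX h57 hnr (fun Wd _ _ hXa ↦ h₄ Wd p hXa)
      (fun K _ _ Dt β ι hK hdisc hHN hHp hβ hc ↦
        hJ W p K Dt β ι hX hns h57 hv hnr hK hdisc hHN hHp hβ hc))
  refine missingLowerBoundAt_of_classX11b_of_indexLowerBoundNoSurj_of_upperTwist hGZ hKo hWu hGZK
    hmod hnf hFHs hMaz W p hX hp5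
    (fun N _ K _ _ Dt H ι P hN hK hdisc hHN hHp hLt hP hc hPinf ↦
      indexLowerBoundAt_corner_of_certificates hGZ hKo hmod hrec hD36 hChaL W p N K Dt H ι P hX hp5 hN
        hK hdisc hHN hLt hP hPinf (hZ W p N K Dt H.β ι hX hns h57 hv hnr hN hK hdisc hHN hHp H.dvd_sq_sub hc))
    ?_
  intro K _ _ Wd _ _ Cd hK hHN hLt hWd hnsd
  have hD0 : (NumberField.discr K : ℚ) ≠ 0 := by exact_mod_cast NumberField.discr_ne_zero K
  haveI : (W.quadraticTwist (NumberField.discr K : ℚ)).IsElliptic := W.isElliptic_quadraticTwist hD0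
  have hrd : Wd.analyticRank = 0 := by
    rw [← hWd, analyticRank_smul]
    exact analyticRank_eq_zero_of_entireLFunction_one_ne_zero _ hLt
  have hXa : ClassX11a Wd p := classX11a_twist_of_not_ram W p hX hnr K hK hHN Cd hWd hrd
  have hpN : p ∣ W.conductorNorm ℤ := dvd_conductorNorm_of_mult hX.2.2.1
  have hsq := isSquare_discr_padic_of_heegner K hK hHN p hpN
  have hvd : p ∣ padicValInt p Wd.minimalDiscriminantInt := by
    rw [padicValInt_minimalDiscriminantInt_twist_eq W p hD0 hsq Cd hWd]
    exact hv
  exact hT Wd p hXa hnsd h57 hvd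

end Summit.BirchSwinnertonDyer.Rank1Residual.X11b

end
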